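import Summits.NavierStokesRegularity.NavierStokesRegularity.Theorems.ArgmaxDoorsNearEngineWeighted
import Summits.NavierStokesRegularity.NavierStokesRegularity.Theorems.ArgmaxDoorsDepletionLocal
import Summits.NavierStokesRegularity.NavierStokesRegularity.Theorems.ArgmaxDoorsDefs
import Literature.Analysis.FluidPDE.ClassicalSolutionGlue
import HarnessLib

/-!
# ArgmaxNearDoorsTools — ROUND-34 §A «ArgmaxNearDoors»: the NEAR-FIELD slab bound (text-independent)

The near-field version of door S35-C: the twist-credited rate at a critical vorticity argmax is charged only
to the vorticity within distance `2r₀(T−t)^β` of the argmax; the far field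
`≤ 8A'(4π/3)^{1/2}(r₀(T−t)^β)^{−3/2}‖ω(t)‖_{L²}` (ns-sfl-p1 g5's `inner_stretching_le_local`) goes into
the barrier as `e^{∫k‖ω‖₂}` (`ArgmaxDoorsNearEngineWeighted`).

* `integral_rpow_neg_sub_le` — `∫₀^{L'}(T'−s)^{−γ} ≤ T'^{1−γ}/(1−γ)` (`γ < 1`);
* `farWeight_sq` — `k(s)² = 64A'²(4π/(3r₀³))·(T'−s)^{−3β}`;
* `near_slab_bound` — from `t₁` on: `|ω(t,x)| ≤ (ε/(T−t) + ‖ω(t₁)‖_∞(T−t₁)^a(T−t)^{−a})·e^{Λ}` for any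
  bound `Λ` of the far-field exponents on slabs starting at `t₁`.

HONEST FRAME / WHAT THIS IS NOT: a regularity CRITERION about hypothetical blow-up (S-door lane, LEAD ns-s30-p1 g3,
nsreg-p1 g30 ROUND-34 §A «ArgmaxNearDoors»; `--supports stmt-NavierStokesRegularity-0056 --as helper`); item
0056 `NoTypeII` and NS regularity are NOT proved; no Literature fact is taken as a hypothesis; nothing here is
a route or a summit statement.
-/

noncomputable section

set_option linter.dupNamespace false

open MeasureTheory Set Function Filter Metric Real InnerProductSpace
open _root_.Topology
open scoped ENNReal NNReal RealInnerProductSpace ContDiff Laplacian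
open Literature.Analysis Literature.Analysis.FluidPDE
open Literature.Analysis.FluidPDE.VorticityDirectionDynamics

namespace Summit.NavierStokesRegularity.NavierStokesRegularity.Theorems.ArgmaxDoors

-- nested operator types (second derivatives)
set_option maxSynthPendingDepth 3

/-! ### §1 Two real lemmas -/

/-- `∫₀^{L'} (T' − s)^{−γ} ds ≤ T'^{1−γ}/(1−γ)` for `0 ≤ L' < T'`, `γ < 1`. [folklore] -/
theorem integral_rpow_neg_sub_le {T' L' γ : ℝ} (hL' : 0 ≤ L') (hLT : L' < T') (hγ : γ < 1) :
    ∫ s in (0 : ℝ)..L', (T' - s) ^ (-γ) ≤ T' ^ (1 - γ) / (1 - γ) := by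
  have h1γ : 0 < 1 - γ := by linarith
  -- primitive `F(s) = −(T' − s)^{1−γ}/(1−γ)`
  have hF : ∀ s ∈ uIcc 0 L', HasDerivAt (fun r : ℝ => -(T' - r) ^ (1 - γ) / (1 - γ)) ((T' - s) ^ (-γ)) s := by
    intro s hs
    rw [uIcc_of_le hL'] at hs
    have hTs : 0 < T' - s := by linarith [hs.2]
    have hlin : HasDerivAt (fun r : ℝ => T' - r) (-1) s := by
      simpa using (hasDerivAt_id s).const_sub T'
    have h := ((hlin.rpow_const (p := 1 - γ) (Or.inl hTs.ne')).neg).div_const (1 - γ)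
    refine h.congr_deriv ?_
    rw [show 1 - γ - 1 = -γ by ring]
    field_simp
  have hcont : ContinuousOn (fun s : ℝ => (T' - s) ^ (-γ)) (uIcc 0 L') := by
    rw [uIcc_of_le hL']
    exact (continuousOn_const.sub continuousOn_id).rpow_const fun s hs =>
      Or.inl (by linarith [hs.2] : T' - s ≠ 0)
  rw [intervalIntegral.integral_eq_sub_of_hasDerivAt hF (hcont.intervalIntegrable)]
  have hpos : 0 ≤ (T' - L') ^ (1 - γ) := Real.rpow_nonneg (by linarith) _
  rw [sub_zero]
  have : -(T' - L') ^ (1 - γ) / (1 - γ) - -(T' ^ (1 - γ)) / (1 - γ) =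
      (T' ^ (1 - γ) - (T' - L') ^ (1 - γ)) / (1 - γ) := by ring
  rw [this, div_le_div_iff_of_pos_right h1γ]
  linarith

/-- The far-field weight of the shrinking ball `R(s) = r₀(T'−s)^β`: with
`k(s) = 8A'·(4π/(3R(s)³))^{1/2}`, `k(s)² = (64A'²·4π/(3r₀³))·(T'−s)^{−3β}`. [folklore] -/
theorem farWeight_sq {A' r₀ β T' s : ℝ} (hr₀ : 0 < r₀) (hTs : 0 < T' - s) :
    (8 * A' * (4 * π / (3 * (r₀ * (T' - s) ^ β) ^ 3)) ^ (1 / (2 : ℝ))) ^ 2 =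
      64 * A' ^ 2 * (4 * π / (3 * r₀ ^ 3)) * (T' - s) ^ (-(3 * β)) := by
  have hR : 0 < r₀ * (T' - s) ^ β := mul_pos hr₀ (Real.rpow_pos_of_pos hTs β)
  have hq : 0 ≤ 4 * π / (3 * (r₀ * (T' - s) ^ β) ^ 3) := by positivity
  rw [mul_pow, ← Real.rpow_natCast ((4 * π / (3 * (r₀ * (T' - s) ^ β) ^ 3)) ^ (1 / (2 : ℝ))) 2,
    ← Real.rpow_mul hq]
  norm_num
  have h3 : (r₀ * (T' - s) ^ β) ^ 3 = r₀ ^ 3 * (T' - s) ^ (3 * β) := by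
    rw [mul_pow, ← Real.rpow_natCast ((T' - s) ^ β) 3, ← Real.rpow_mul hTs.le]
    push_cast
    ring_nf
  rw [h3, Real.rpow_neg hTs.le]
  have hpow : 0 < (T' - s) ^ (3 * β) := Real.rpow_pos_of_pos hTs _
  field_simp
  ring


/-! ### §2 The slab bound -/

set_option maxHeartbeats 800000 in
-- long but linear bookkeeping (translation + rate split + barrier)
/-- **Near-field slab bound.** In the open frame on `[0,T)`, with the local depletion split `hloc` (the shape of
`ArgmaxDoorsDepletionLocal.inner_stretching_le_local` for constants `A, A'`) and the NEAR-FIELD door hypothesis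
on `[t₀,T)` (ball radius `2r₀(T−t)^β` around the argmax, critical times `(T−t)|ω(x̄)| > ε`), for every
`t₁ ∈ [t₀,T)` and every bound `Λ` of the far-field exponents `∫₀^{t'} k(s)‖ω(s+t₁)‖_{L²} ds` on slabs
`[0,L] ⊂ [0,T−t₁)` (`k(s) = 8A'(4π/(3(r₀(T−t₁−s)^β)³))^{1/2}`): for all `t ∈ [t₁,T)` and `x`,
`|ω(t,x)| ≤ (ε/(T−t) + M₁(T−t₁)^a(T−t)^{−a})·e^{Λ}`, `M₁ = ‖ω(t₁)‖_∞`. [folklore] -/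
theorem near_slab_bound {A A' ν T t₀ t₁ r₀ β a ε Λ : ℝ} (hA' : 0 ≤ A') (hν : 0 < ν) (ht₀ : 0 ≤ t₀)
    (ht₁ : t₁ ∈ Ico t₀ T) (hr₀ : 0 < r₀) (ha : a ≤ 1) (hε : 0 < ε)
    {u : ℝ → (EuclideanSpace ℝ (Fin 3)) → (EuclideanSpace ℝ (Fin 3))}
    {p : ℝ → (EuclideanSpace ℝ (Fin 3)) → ℝ} (hsol : IsClassicalNSSolutionOn (Ico 0 T) ν 0 u p)
    (hreg : ∀ T'' < T, HasBoundedSobolevNormsOn (Icc 0 T'') u)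
    (hloc : ∀ t ∈ Ico 0 T, ∀ x, curl (u t) x ≠ 0 → ∀ R : ℝ, 0 < R →
        Integrable (fun y => ‖curl (u t) y‖ ^ 2) ∧
        ⟪curl (u t) x, fderiv ℝ (u t) x (curl (u t) x)⟫ ≤ ‖curl (u t) x‖ ^ 2 *
          (A * (∫ y in ball x (2 * R), ‖curl (u t) y - ⟪curl (u t) y, vorticityDirection (curl (u t)) x⟫ •
              vorticityDirection (curl (u t)) x‖ * (‖x - y‖ ^ 3)⁻¹) +
            8 * A' * ((4 * π / (3 * R ^ 3)) ^ (1 / (2 : ℝ)) * (∫ y, ‖curl (u t) y‖ ^ 2) ^ (1 / (2 : ℝ)))))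
    (hhyp : ∀ t ∈ Ico t₀ T, ∀ x, (∀ y, ‖curl (u t) y‖ ≤ ‖curl (u t) x‖) → ε < (T - t) * ‖curl (u t) x‖ →
      (T - t) * (‖curl (u t) x‖ ^ 2 *
        (A * (∫ y in ball x (2 * (r₀ * (T - t) ^ β)),
          ‖curl (u t) y - ⟪curl (u t) y, vorticityDirection (curl (u t)) x⟫ •
            vorticityDirection (curl (u t)) x‖ * (‖x - y‖ ^ 3)⁻¹) -
          ν * frobeniusNormSq (fderiv ℝ (vorticityDirection (curl (u t))) x))) ≤
        a * ‖curl (u t) x‖ ^ 2)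
    (hΛ : ∀ L : ℝ, 0 < L → L < T - t₁ → ∀ t' ∈ Icc 0 L,
      ∫ s in (0 : ℝ)..t', (8 * A' * (4 * π / (3 * (r₀ * (T - t₁ - s) ^ β) ^ 3)) ^ (1 / (2 : ℝ))) *
        (eLpNorm (curl (u (s + t₁))) 2 volume).toReal ≤ Λ) :
    ∀ t ∈ Ico t₁ T, ∀ x, ‖curl (u t) x‖ ≤
      (ε / (T - t) + supVorticity u t₁ * (T - t₁) ^ a * (T - t) ^ (-a)) * Real.exp Λ := by
  intro t ht x
  have ht₁T : t₁ < T := ht₁.2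
  have hTt₁ : 0 < T - t₁ := sub_pos.2 ht₁T
  set M₁ : ℝ := supVorticity u t₁ with hM₁
  have hM₁0 : 0 ≤ M₁ := supVorticity_nonneg u t₁
  set c : ℝ := M₁ * (T - t₁) ^ a with hc
  have hc0 : 0 ≤ c := mul_nonneg hM₁0 (Real.rpow_nonneg hTt₁.le a)
  -- the closed slab `[t₁, T'']`, `T'' = (t+T)/2`, translated to `[0, L]`
  set T'' : ℝ := (t + T) / 2 with hT''
  have htT'' : t ≤ T'' := by rw [hT'']; linarith [ht.2]
  have hT''T : T'' < T := by rw [hT'']; linarith [ht.2]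
  set L : ℝ := T'' - t₁ with hLdef
  have hL : 0 < L := by rw [hLdef, hT'']; linarith [ht.1, ht.2]
  set Trel : ℝ := T - t₁ with hTrel
  have hLT : L < Trel := by rw [hLdef, hTrel]; linarith
  set v : ℝ → (EuclideanSpace ℝ (Fin 3)) → (EuclideanSpace ℝ (Fin 3)) := fun s => u (s + t₁) with hv
  set q : ℝ → (EuclideanSpace ℝ (Fin 3)) → ℝ := fun s => p (s + t₁) with hq
  have hmem : ∀ s ∈ Icc (0 : ℝ) L, s + t₁ ∈ Ico t₀ T := fun s hs =>
    ⟨by linarith [hs.1, ht₁.1], by rw [hLdef] at hs; linarith [hs.2]⟩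
  have hS : IsClassicalNSSolutionOn (Icc 0 L) ν 0 v q :=
    (hsol.translate_Ico_zero (ht₀.trans ht₁.1)).mono
      (fun s hs => ⟨hs.1, by rw [hLdef] at hs; linarith [hs.2]⟩) (uniqueDiffOn_Icc hL)
  have hB : HasBoundedSobolevNormsOn (Icc 0 L) v := by
    intro n
    obtain ⟨C', hC'⟩ := hreg T'' hT''T n
    exact ⟨C', fun s hs => hC' (s + t₁) ⟨by linarith [hs.1, ht₁.1, ht₀], by rw [hLdef] at hs; linarith [hs.2]⟩⟩
  have hτ : ∀ s ∈ Icc (0 : ℝ) L, 0 < Trel - s := fun s hs => by linarith [hs.2]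
  -- the far-field weight
  set k : ℝ → ℝ := fun s => 8 * A' * (4 * π / (3 * (r₀ * (Trel - s) ^ β) ^ 3)) ^ (1 / (2 : ℝ)) with hk
  have hk0 : ∀ s ∈ Icc 0 L, 0 ≤ k s := fun s hs => by
    rw [hk]
    exact mul_nonneg (by positivity) (Real.rpow_nonneg (div_nonneg (by positivity)
      (mul_nonneg (by norm_num) (pow_nonneg (mul_nonneg hr₀.le (Real.rpow_nonneg (hτ s hs).le _)) 3))) _)
  have hkc : ContinuousOn k (Icc 0 L) := by
    have h1 : ContinuousOn (fun s : ℝ => Trel - s) (Icc 0 L) := continuousOn_const.sub continuousOn_id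
    have h2 : ContinuousOn (fun s : ℝ => (Trel - s) ^ β) (Icc 0 L) :=
      h1.rpow_const fun s hs => Or.inl (hτ s hs).ne'
    have h3 : ContinuousOn (fun s : ℝ => 4 * π / (3 * (r₀ * (Trel - s) ^ β) ^ 3)) (Icc 0 L) :=
      continuousOn_const.div (continuousOn_const.mul ((continuousOn_const.mul h2).pow 3))
        fun s hs => by
          have : 0 < r₀ * (Trel - s) ^ β := mul_pos hr₀ (Real.rpow_pos_of_pos (hτ s hs) β)
          positivity
    have h4 : ContinuousOn (fun s : ℝ => (4 * π / (3 * (r₀ * (Trel - s) ^ β) ^ 3)) ^ (1 / (2 : ℝ)))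
        (Icc 0 L) := h3.rpow_const fun s hs => Or.inr (by norm_num)
    exact continuousOn_const.mul h4
  -- the rate at critical argmaxima of the translated solution
  set ψ : ℝ → ℝ := fun s => (eLpNorm (curl (v s)) 2 volume).toReal with hψ
  have hrate : ∀ s ∈ Icc 0 L, 0 < s → ∀ x₀ : EuclideanSpace ℝ (Fin 3),
      (∀ y, ‖curl (v s) y‖ ≤ ‖curl (v s) x₀‖) → ε < (Trel - s) * ‖curl (v s) x₀‖ →
      ⟪vorticityDirection (curl (v s)) x₀, fderiv ℝ (v s) x₀ (vorticityDirection (curl (v s)) x₀)⟫ -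
          ν * frobeniusNormSq (fderiv ℝ (vorticityDirection (curl (v s))) x₀) ≤
        a / (Trel - s) + k s * (eLpNorm (curl (v s)) 2 volume).toReal := by
    intro s hs hspos x₀ hmax hcrit
    have hst : s + t₁ ∈ Ico t₀ T := hmem s hs
    have hst0 : s + t₁ ∈ Ico 0 T := ⟨ht₀.trans hst.1, hst.2⟩
    have hτs : 0 < Trel - s := hτ s hs
    have hTT : T - (s + t₁) = Trel - s := by rw [hTrel]; ring
    have hne : curl (u (s + t₁)) x₀ ≠ 0 := by
      intro h0
      have : ‖curl (v s) x₀‖ = 0 := by simp only [hv, h0, norm_zero]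
      rw [this, mul_zero] at hcrit
      linarith
    have hω2 : 0 < ‖curl (u (s + t₁)) x₀‖ ^ 2 := pow_pos (norm_pos_iff.2 hne) 2
    set R : ℝ := r₀ * (Trel - s) ^ β with hR
    have hRpos : 0 < R := mul_pos hr₀ (Real.rpow_pos_of_pos hτs β)
    obtain ⟨hI2, hsplit⟩ := hloc (s + t₁) hst0 x₀ hne R hRpos
    have hdoor := hhyp (s + t₁) hst x₀ hmax (by rw [hTT]; exact hcrit)
    rw [hTT] at hdoor
    -- `ψ s = (∫‖ω‖²)^{1/2}`
    have hv3 : ContDiff ℝ 3 (u (s + t₁)) := (hsol.contDiff_velocity hst0).of_le (by norm_cast)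
    have hψs : (eLpNorm (curl (v s)) 2 volume).toReal = (∫ y, ‖curl (u (s + t₁)) y‖ ^ 2) ^ (1 / (2 : ℝ)) := by
      rw [show curl (v s) = curl (u (s + t₁)) from rfl,
        toReal_eLpNorm_two_eq_sqrt (continuous_curl (hv3.of_le (by norm_cast))) hI2, Real.sqrt_eq_rpow]
    -- `netStretch ≤ (a/(Trel−s) + k s ψ s)·|ω|²`
    refine rate_le_of_netStretch_le (u := v) (t := s) hne ?_
    show netStretch ν v s x₀ ≤ _
    have hnet : netStretch ν v s x₀ = ⟪curl (u (s + t₁)) x₀, fderiv ℝ (u (s + t₁)) x₀ (curl (u (s + t₁)) x₀)⟫ -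
        ν * ‖curl (u (s + t₁)) x₀‖ ^ 2 *
          frobeniusNormSq (fderiv ℝ (vorticityDirection (curl (u (s + t₁)))) x₀) := rfl
    rw [hnet, hψs]
    set P : ℝ := ‖curl (u (s + t₁)) x₀‖ ^ 2 with hP
    set Inear : ℝ := ∫ y in ball x₀ (2 * R), ‖curl (u (s + t₁)) y -
        ⟪curl (u (s + t₁)) y, vorticityDirection (curl (u (s + t₁))) x₀⟫ •
          vorticityDirection (curl (u (s + t₁))) x₀‖ * (‖x₀ - y‖ ^ 3)⁻¹ with hInear
    set Ffar : ℝ := (4 * π / (3 * R ^ 3)) ^ (1 / (2 : ℝ)) * (∫ y, ‖curl (u (s + t₁)) y‖ ^ 2) ^ (1 / (2 : ℝ))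
      with hFfar
    set Fr : ℝ := frobeniusNormSq (fderiv ℝ (vorticityDirection (curl (u (s + t₁)))) x₀) with hFr
    -- `hsplit : ⟪ω,(∇u)ω⟫ ≤ P (A Inear + 8A' Ffar)`, `hdoor : (Trel−s)(P(A Inear − ν Fr)) ≤ a P`
    have h1 : P * (A * Inear - ν * Fr) ≤ a / (Trel - s) * P := by
      rw [div_mul_eq_mul_div, le_div_iff₀ hτs]
      linarith [hdoor]
    have hkψ : k s * ((∫ y, ‖curl (u (s + t₁)) y‖ ^ 2) ^ (1 / (2 : ℝ))) = 8 * A' * Ffar := by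
      simp only [hk, hFfar, hR]; ring
    have hP0 : 0 ≤ P := sq_nonneg _
    calc ⟪curl (u (s + t₁)) x₀, fderiv ℝ (u (s + t₁)) x₀ (curl (u (s + t₁)) x₀)⟫ - ν * P * Fr
        ≤ P * (A * Inear + 8 * A' * Ffar) - ν * P * Fr := by linarith [hsplit]
      _ = P * (A * Inear - ν * Fr) + (8 * A' * Ffar) * P := by ring
      _ ≤ a / (Trel - s) * P + (k s * (∫ y, ‖curl (u (s + t₁)) y‖ ^ 2) ^ (1 / (2 : ℝ))) * P := by
          rw [hkψ]; linarith [h1]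
      _ = (a / (Trel - s) + k s * (∫ y, ‖curl (u (s + t₁)) y‖ ^ 2) ^ (1 / (2 : ℝ))) * P := by ring
  -- the initial bound
  have hMbd : ∀ y, ‖curl (v 0) y‖ ≤ ε / Trel + c * Trel ^ (-a) := by
    intro y
    have h1 : ‖curl (u t₁) y‖ ≤ M₁ := norm_curl_le_supVorticity hsol hreg ⟨ht₀.trans ht₁.1, ht₁T⟩ y
    have h2 : c * Trel ^ (-a) = M₁ := by
      rw [hc, hTrel, mul_assoc, ← Real.rpow_add hTt₁, add_neg_cancel, Real.rpow_zero, mul_one]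
    have h3 : 0 ≤ ε / Trel := (div_pos hε hTt₁).le
    simp only [hv, zero_add]
    linarith
  -- the barrier
  have hbar := norm_curl_le_barrier_exp_of_argmax_rate_le_weighted hν hL hLT ha hε hc0 hkc hk0 hS hB
    hrate hMbd (t - t₁) ⟨by linarith [ht.1], by rw [hLdef]; linarith⟩ x
  have hTT : Trel - (t - t₁) = T - t := by rw [hTrel]; ring
  have hvt : v (t - t₁) = u t := by simp [hv]
  rw [hvt, hTT] at hbar
  -- the exponent
  have hexp : ∫ r in (0 : ℝ)..(t - t₁), k r * (eLpNorm (curl (v r)) 2 volume).toReal ≤ Λ :=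
    hΛ L hL hLT (t - t₁) ⟨by linarith [ht.1], by rw [hLdef]; linarith⟩
  have hB0 : 0 ≤ ε / (T - t) + c * (T - t) ^ (-a) :=
    add_nonneg (div_pos hε (sub_pos.2 ht.2)).le (mul_nonneg hc0 (Real.rpow_nonneg (sub_pos.2 ht.2).le _))
  calc ‖curl (u t) x‖ ≤ (ε / (T - t) + c * (T - t) ^ (-a)) *
        Real.exp (∫ r in (0 : ℝ)..(t - t₁), k r * (eLpNorm (curl (v r)) 2 volume).toReal) := hbar
    _ ≤ (ε / (T - t) + c * (T - t) ^ (-a)) * Real.exp Λ :=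
        mul_le_mul_of_nonneg_left (Real.exp_le_exp.2 hexp) hB0
    _ = (ε / (T - t) + supVorticity u t₁ * (T - t₁) ^ a * (T - t) ^ (-a)) * Real.exp Λ := by
        rw [hc]


end Summit.NavierStokesRegularity.NavierStokesRegularity.Theorems.ArgmaxDoors

end
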